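import Summits.MatrixMultiplication.OmegaCensus.DominoZpZpStructFive
import HarnessLib

/-!
# Structural part-`5` route: closure of the excluded list under unit scalings from ONE generator

ω-census `pub-omega`, family (b3), seat pub-omega-group gen 23.  Framing: lottery ticket; floor = certified bounds/negative
ranges.  VALUE: kernel economy for the larger primes of the structural part-`5` route (`p = 31`: excluded list of 150 count
vectors): the closure hypothesis `hE2` of `ZpZpDomino.exists_goodP` (closure of `E` under ALL `p − 1` unit scalings, decided by
`checkE2` with `|E|·(p−1)` scalings) follows from closure under ONE primitive root `g` (`checkE2g`: `|E|` scalings plus a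
primitive-root table), via the composition law `scaleVec p κ (scaleVec p μ k) = scaleVec p (μκ mod p) k`;
`exists_entry_structFive_of_checks_gen` is the corresponding variant of `exists_entry_structFive_of_checks`; NOT progress on ω.
-/

namespace Summit.MatrixMultiplication.OmegaCensus

open Finset

namespace ZpZpDomino

/-! ## Programs -/

/-- `g` generates the units mod `p`: every `κ ∈ [1, p)` is `g^(n+1) mod p` for some `n < p`. [folklore] -/
def isGenB (p g : ℕ) : Bool :=
  (List.range p).all fun κ => (κ == 0) || (List.range p).any fun n => g ^ (n + 1) % p == κ

/-- Closure of `E` under the single scaling `v ↦ g·v`, with `g` a unit generating all units. [folklore] -/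
def checkE2g (p g : ℕ) (E : List (List ℕ)) : Bool :=
  !(g % p == 0) && (isGenB p g && E.all fun k => E.contains (scaleVec p g k))

/-! ## Soundness -/

section Sound

variable {p : ℕ} [Fact p.Prime]

omit [Fact p.Prime] in
/-- Entries of `scaleVec`. [folklore] -/
theorem getD_scaleVec (κ : ℕ) (k : List ℕ) {w : ℕ} (hw : w < p) :
    (scaleVec p κ k).getD w 0 = k.getD (invMod p κ * w % p) 0 := by
  simp [scaleVec, List.getD_eq_getElem?_getD, List.getElem?_range hw]

omit [Fact p.Prime] in
/-- `invMod` only depends on the residue of its argument. [folklore] -/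
theorem invMod_mod (x : ℕ) : invMod p (x % p) = invMod p x := by
  unfold invMod
  have : (fun v => x % p * v % p == 1) = (fun v => x * v % p == 1) := by
    funext v; rw [Nat.mod_mul_mod]
  rw [this]

omit [Fact p.Prime] in
/-- `scaleVec` only depends on the residue of the scalar. [folklore] -/
theorem scaleVec_mod (x : ℕ) (k : List ℕ) : scaleVec p (x % p) k = scaleVec p x k := by
  unfold scaleVec; rw [invMod_mod]

/-- `invMod` of a unit, cast to `ZMod p`, is the inverse. [folklore] -/
theorem natCast_invMod_nat {κ : ℕ} (hκ : κ % p ≠ 0) :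
    ((invMod p κ : ℕ) : ZMod p) = ((κ : ℕ) : ZMod p)⁻¹ := by
  have hκ' : ((κ : ℕ) : ZMod p) ≠ 0 := by rwa [Ne, ZMod.natCast_eq_zero_iff, Nat.dvd_iff_mod_eq_zero]
  have e := natCast_invMod hκ'
  rwa [ZMod.val_natCast, invMod_mod] at e

/-- **Composition law**: `scaleVec p κ (scaleVec p μ k) = scaleVec p (μ·κ mod p) k` for units `κ, μ`. [folklore] -/
theorem scaleVec_scaleVec {κ μ : ℕ} (hκ : κ % p ≠ 0) (hμ : μ % p ≠ 0) (k : List ℕ) :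
    scaleVec p κ (scaleVec p μ k) = scaleVec p (μ * κ % p) k := by
  have hp := (Fact.out : p.Prime).pos
  have hμκ : μ * κ % p % p ≠ 0 := by
    rw [Nat.mod_mod]
    intro h
    rcases (Nat.Prime.dvd_mul (Fact.out : p.Prime)).1 (Nat.dvd_of_mod_eq_zero h) with h1 | h1
    · exact hμ (Nat.mod_eq_zero_of_dvd h1)
    · exact hκ (Nat.mod_eq_zero_of_dvd h1)
  unfold scaleVec
  refine List.map_congr_left fun w hw => ?_
  rw [List.mem_range] at hw
  have hi : invMod p κ * w % p < p := Nat.mod_lt _ hp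
  have e : ((List.range p).map fun w' => k.getD (invMod p μ * w' % p) 0).getD (invMod p κ * w % p) 0 =
      k.getD (invMod p μ * (invMod p κ * w % p) % p) 0 := by
    simp [List.getD_eq_getElem?_getD, List.getElem?_range hi]
  rw [e]
  congr 1
  refine Nat.ModEq.eq_of_lt_of_lt ?_ (Nat.mod_lt _ hp) (Nat.mod_lt _ hp)
  rw [Nat.ModEq, ← ZMod.natCast_eq_natCast_iff']
  simp only [Nat.cast_mul, ZMod.natCast_mod, natCast_invMod_nat hκ, natCast_invMod_nat hμ, natCast_invMod_nat hμκ]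
  rw [mul_inv]
  ring

/-- **`checkE2g` ⇒ `hE2`**: closure under one generator gives closure under every unit scaling. [folklore] -/
theorem hE2_of_checkE2g {g : ℕ} {E : List (List ℕ)} (h : checkE2g p g E = true) :
    ∀ k ∈ E, ∀ κ : ℕ, 1 ≤ κ → κ < p → scaleVec p κ k ∈ E := by
  simp only [checkE2g, isGenB, Bool.and_eq_true, Bool.not_eq_true', beq_eq_false_iff_ne, ne_eq, List.all_eq_true,
    List.mem_range, Bool.or_eq_true, beq_iff_eq, List.any_eq_true, List.contains_iff_mem] at h
  obtain ⟨hg, hgen, hcl⟩ := h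
  -- all positive powers of `g` keep `E` stable
  have hpow : ∀ m : ℕ, ∀ k ∈ E, scaleVec p (g ^ (m + 1) % p) k ∈ E := by
    intro m
    induction m with
    | zero => intro k hk; rw [zero_add, pow_one, scaleVec_mod]; exact hcl k hk
    | succ m ih =>
      intro k hk
      have hunit : g ^ (m + 1) % p % p ≠ 0 := by
        rw [Nat.mod_mod]
        intro h0
        exact hg (Nat.mod_eq_zero_of_dvd
          (Nat.Prime.dvd_of_dvd_pow (Fact.out : p.Prime) (Nat.dvd_of_mod_eq_zero h0)))
      have e := scaleVec_scaleVec (p := p) hg hunit k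
      rw [Nat.mod_mul_mod, ← pow_succ] at e
      rw [← e]
      exact hcl _ (ih k hk)
  intro k hk κ h1 hκ
  rcases hgen κ hκ with h0 | ⟨n, -, hn⟩
  · omega
  · rw [← hn]; exact hpow n k hk

end Sound

/-! ## Assembly with the generator check -/

section Assembly

variable {p : ℕ} [Fact p.Prime]

/-- **Structural cover theorem for part `5`, Bool hypotheses with the ONE-GENERATOR closure check** (`checkE2g` in place of
`checkE2`). [folklore] -/
theorem exists_entry_structFive_of_checks_gen (E R : List (List ℕ)) (g : ℕ) (h1 : checkE1 E = true)
    (h1' : checkE1' p E = true) (h2 : checkE2g p g E = true) (hR : checkR p E R = true)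
    (hchk3 : checkH3 p (E.map (polyBE 6)) (allArr23 p R) R = true) (T : List (List ℕ × List (ℕ × List ℕ))) (tt : BTree)
    (htt : ∀ x, tt.mem x = true → x ∈ T.map fun e => polyBE 6 e.1) (hWF : tabWF p 6 T = true)
    (hEwf : checkEwf p E = true) (hchk : checkFive p (E.map (polyBE 6)) tt = true) (g' : Fin (p * p) → ℕ)
    (hg : ∑ i, g' i = 5) :
    ∃ j < p + 1, ∃ k : ℕ, k % p ≠ 0 ∧ ∃ e ∈ T, ∀ v < p,
      e.1.getD (k * v % p) 0 = ∑ i : Fin (p * p), pick v (pv p j i.val) (g' i) :=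
  exists_entry_structFive E R (hE1_of_check h1) (hE1'_of_check h1') (hE2_of_checkE2g h2) (hR_of_check hR) hchk3 T tt htt
    hWF hEwf hchk g' hg

end Assembly

end ZpZpDomino

end Summit.MatrixMultiplication.OmegaCensus
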